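import Literature.ModelTheory.ExponentialFields.TarskiSeidenbergProofs
import Mathlib.Topology.Order.IntermediateValue
import Mathlib.Topology.Algebra.MvPolynomial
import HarnessLib

/-!
# Connected sign-invariant sets lie inside or outside a semialgebraic set

If a `k`-semialgebraic set `B ⊆ ℝⁿ` is presented by sign conditions on a finite family `𝒬` of
polynomials (`IsSemialgebraic.exists_eq_setOf_signVec_mem`), and `Σ ⊆ ℝⁿ` is a preconnected set
on which every member of `𝒬` either has no zero or vanishes identically, then the sign vector of
`𝒬` is constant on `Σ` (intermediate value theorem), hence `Σ ⊆ B` or `Σ ∩ B = ∅`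
(`subset_or_disjoint_of_forall_ne_zero_or_eq_zero`). This is the elementary mechanism by which the
cells of a cylindrical decomposition adapted to `𝒬` are adapted to `B`
(Basu–Pollack–Roy 2006, §5.1, proof of Cor. 5.7), isolated for re-use with other connected
sign-invariant pieces (open slabs between consecutive root functions).

## References

* S. Basu, R. Pollack, M.-F. Roy, *Algorithms in Real Algebraic Geometry*, 2nd ed. (2006),
  Prop. 5.3, Cor. 5.7.
-/

noncomputable section

open Set

namespace Literature.ModelTheory.ExponentialFields

variable {k : Type*} [CommRing k] [Algebra k ℝ] {n : ℕ}

/-- Polynomial functions over `k` are continuous on `ℝⁿ`. [folklore] -/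
theorem continuous_aeval' (p : MvPolynomial (Fin n) k) :
    Continuous fun x : Fin n → ℝ => MvPolynomial.aeval x p := by
  have h : (fun x : Fin n → ℝ => MvPolynomial.aeval x p) =
      fun x => MvPolynomial.eval x (MvPolynomial.map (algebraMap k ℝ) p) := by
    funext x
    rw [MvPolynomial.eval_map, MvPolynomial.aeval_def]
  rw [h]
  exact MvPolynomial.continuous_eval _

/-- On a preconnected set, a continuous real function without zeros has constant sign.
[folklore] -/
theorem sign_eq_sign_of_isPreconnected {S : Set (Fin n → ℝ)} (hS : IsPreconnected S) {f : (Fin n → ℝ) → ℝ}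
    (hf : ContinuousOn f S) (hne : ∀ x ∈ S, f x ≠ 0) {x y : Fin n → ℝ} (hx : x ∈ S) (hy : y ∈ S) :
    SignType.sign (f x) = SignType.sign (f y) := by
  rcases lt_trichotomy (f x) 0 with hx0 | hx0 | hx0 <;>
    rcases lt_trichotomy (f y) 0 with hy0 | hy0 | hy0
  · rw [sign_neg hx0, sign_neg hy0]
  · exact absurd hy0 (hne y hy)
  · obtain ⟨z, hz, hz0⟩ := hS.intermediate_value hx hy hf ⟨hx0.le, hy0.le⟩
    exact absurd hz0 (hne z hz)
  · exact absurd hx0 (hne x hx)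
  · exact absurd hx0 (hne x hx)
  · exact absurd hx0 (hne x hx)
  · obtain ⟨z, hz, hz0⟩ := hS.intermediate_value hy hx hf ⟨hy0.le, hx0.le⟩
    exact absurd hz0 (hne z hz)
  · exact absurd hy0 (hne y hy)
  · rw [sign_pos hx0, sign_pos hy0]

/-- **Connected sign-invariant sets are adapted.** Let `B = {x | (sign q(x))_{q ∈ 𝒬} ∈ T}` be
presented by sign conditions on the finite family `𝒬`, and let `S` be preconnected such that every
`q ∈ 𝒬` either has no zero on `S` or vanishes identically on `S`. Then `S ⊆ B` or `S ∩ B = ∅`.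
[cite: BasuPollackRoy2006, Cor. 5.7 (proof)] -/
theorem subset_or_disjoint_of_forall_ne_zero_or_eq_zero {𝒬 : Finset (MvPolynomial (Fin n) k)}
    {T : Set (𝒬 → SignType)} {B S : Set (Fin n → ℝ)}
    (hB : B = {x | (fun q : 𝒬 => SignType.sign (MvPolynomial.aeval x (q : MvPolynomial (Fin n) k))) ∈ T})
    (hS : IsPreconnected S)
    (hq : ∀ q : 𝒬, (∀ x ∈ S, MvPolynomial.aeval x (q : MvPolynomial (Fin n) k) ≠ 0) ∨
      (∀ x ∈ S, MvPolynomial.aeval x (q : MvPolynomial (Fin n) k) = 0)) :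
    S ⊆ B ∨ Disjoint S B := by
  have hconst : ∀ x ∈ S, ∀ y ∈ S,
      (fun q : 𝒬 => SignType.sign (MvPolynomial.aeval x (q : MvPolynomial (Fin n) k))) =
      fun q : 𝒬 => SignType.sign (MvPolynomial.aeval y (q : MvPolynomial (Fin n) k)) := by
    intro x hx y hy
    funext q
    rcases hq q with h | h
    · exact sign_eq_sign_of_isPreconnected hS
        (continuous_aeval' (q : MvPolynomial (Fin n) k)).continuousOn h hx hy
    · simp only [h x hx, h y hy]
  by_cases hSB : (S ∩ B).Nonempty
  · obtain ⟨x, hxS, hxB⟩ := hSB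
    refine Or.inl fun y hy => ?_
    rw [hB] at hxB ⊢
    simp only [mem_setOf_eq] at hxB ⊢
    rwa [hconst y hy x hxS]
  · exact Or.inr (disjoint_iff_inter_eq_empty.2 (not_nonempty_iff_eq_empty.1 hSB))

end Literature.ModelTheory.ExponentialFields
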